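import Literature.MathematicalPhysics.QuantumFieldTheory.Balaban1983to89.Node00.Record13SepCoPH

/-!
# `Balaban1983to89.T4DatumAssemblyTowerReviseAE` — T. Bałaban, *Convergent renormalization expansions for lattice gauge theories*, Commun. Math. Phys. **119**
(1988) 243–285 [Balaban1988Convergent] (0.2) p. 244, Cor. 3 (2.50) p. 264; *Large field renormalization. II*, Commun. Math. Phys. **122** (1989) 355–392
[Balaban1989LargeFieldII] Thm 1 + (0.1) pp. 355–356:
**RE-CHOOSING THE DENSITY TOWER OF A TOWER DATUM ABOVE LEVEL 0 ON `dV_k`-NULL SETS — the tower obligations survive, and (2.50) `dV_k`-a.e. becomes (2.50) AS TYPED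
for the re-chosen datum, with the same averaging, flow, β-functions and small-field data**

statement-level skeleton of published theorems with citation tags; proofs where landed; nothing here is a claim about the
Yang–Mills mass gap

CITATION HEADER (verbatim).  [Balaban1988Convergent] (0.2) p. 244: *«ρ_{k+1} = R T ρ_k»*; Cor. 3 (2.50) p. 264: *«χ_k(T_η) exp[−(1∕g_k²)A(U_k(V_k)) − E₋|T_η|] ≤
ρ_k(V_k) ≤ e^{E₊|T_η|}»* — stated for every configuration `V_k`; [Balaban1989LargeFieldII] (0.1) pp. 355–356 (the same with `E₋, E₊` fixed) and Thm 1 p. 355; [Balaban1989LargeFieldI]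
(0.4) p. 176: *«∫ dV (Rρ)(V) = ∫ dV ρ(V)»*.  NOT PRINTED: the distinction between (2.50) at EVERY field and (2.50) for `dV_k`-ALMOST EVERY field — print's densities are explicit
continuous functions; the tree's level-≥1 densities of record are built from Radon–Nikodym ∕ conditional-kernel VERSIONS (def-T's (†), `T4AveragingDisintegration.margDensity =
rnNN`), fixed `dV`-a.e. only, so the two readings differ there (cell `pub-ymgap` plan g84 WORD-3∕3b, director-ym №210: «misstated by inheritance (display currency)»).

WHY THIS FILE (cell `pub-ymgap`, HUMAN RULING D-0062 Track A ∕ D-0149 width; node N13 = [B16]; WIDTH SEAT `pub-ymgap-dag-n13-w1` gen 5, CLAIM-2; `--kind proof --supports`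
K1⁸ `StabilityBRunRowsAtRecordR13SepCoPH` = stmt-QuantumFields-26907 `--as helper`; count-neutral).  The (B) conjunct `B16.EndStatementBPrinted (datumOfRecord₁₃SepCoPH F 2 θ h).C` of the
deciding item reads (2.50) at EVERY field of a chosen version (this seat's `Summits/…/BalabanUVNodesK1R8VersionPinOnNullUnitFibre`, p618356; the sibling's p610399 ∕ p617654); the
director's № word №210 is repair road (δ) NULL-SET SURGERY — «(B)ᴬᴱ at D ⇒ ∃ D′, D′.av = D.av ∧ densities =ᵐ ∧ EndStatementBPrinted D′.C pointwise», DEF-LEVEL FIRST — and the plan's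
WORD-3b prices it as a `Tower.revise` wrapper (definers' file `Node00/Record13SepCoPHV`, the «version slot» (δⱽ)).  THIS FILE is the generic KERNEL CONTENT of that surgery over
`T4DatumAssembly`'s carriers, Literature-side so that the definers' wrapper can import it: an `RGMachineCore.Tower` has exactly three obligations — `rho_zero` (level 0, kept
verbatim), `isRT_Trho` and `integral_succ` (which read `ρ_k` only under `∫ … ∂dU`) — and `Tower.datum` realises the construction with `R := inducedR` OF THE NEW TOWER, so
`Realisation.rho_succ_eq` holds by construction (`inducedR_Trho`): no tower re-run, no `rnDeriv`, no choice.  The sibling seat dag-n13-w2 g4's `Summits/…/BalabanUVNodesN13Cor3AEIffUpToVersionAtRecord13`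
is the same re-choice at the `B16.Construction` level (and the device `ep ↦ max ep (−em)` of §1 is theirs); nothing of it is restated here — this file works one level up, on towers.

WHAT THIS FILE PROVES (0 `sorry`, 0 `def`; theorems only; generic over the family `F`, a `GaugeGroup G` with `HaarData`, a core `M : RGMachineCore F G`, an averaging family `av`,
a tower `τ : M.Tower av`, except §3b–§4 at `G = SU(N)` ∕ `SU(2)` and NODE 00's averaging ∕ Stage-13 record).
§1 what (2.50) and Theorem 1's clause READ of `M.construction ρ p` (`Iff.rfl`): `uvIneq_construction_iff`, `thm1Printed_construction_iff`, `construction_toB12_eq`; the UPPER BARRIER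
   value satisfies (2.50) when the two printed bounds are compatible (`uvIneq_of_eq_upper`); compatibility from signs (`barrier_le_of_signs`: `χ ≤ 1`, `0 ≤ A`, `0 ≤ Em + Ep`) and,
   with the upper exponent `max Ep (−Em)`, from `χ ≤ 1`, `0 ≤ A` ALONE (`barrier_le_max`); monotonicity in the upper exponent (`uvIneq_mono_upper`).
§2 `isRT_congr_ae_input`; ★ `exists_tower_reChosen_above_zero` — re-choosing `ρ_k`, `k ≥ 1`, to ANY values on `dV_k`-NULL guards gives a tower with the same level 0 and the same `Tρ_k`
   (`ρ′ =ᵐ ρ` at EVERY positive level — the quantifier form DEF-1's `Revision.ae_eq_succ` asks).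
§3 ★★ `exists_tower_endStatementBPrinted_of_ae` — Theorem 1's clause + (2.50) POINTWISE at `k = 0` and `dV_k`-A.E. at `1 ≤ k ≤ K` on the `γ`-windowed runs + compatibility above level 0
   ⟹ a re-chosen tower `τ′` (same level 0, same `Tρ_k`, `ρ′ =ᵐ ρ`) with `B16.EndStatementBPrinted (M.construction τ′.ρ)` AS TYPED.
§3b ★★ `exists_datum_endStatementBPrinted_of_ae` — at `SU(N)` and `av = Node00.avOfRecord`: the datum `D′ = datumOfTower F N M τ′` has `IsDatumOfRecord₀`, the SAME `C.toB12`, `βfun`, `av`,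
   the same level-0 densities, densities `=ᵐ` above, and `B16.EndStatementBPrinted D′.C`.
§4 [record, `N = 2`] `datumOfRecord₁₃SepCoPH_eq_datumOfTower` (`rfl`); `compat_at_record_max` (`χ^{(2.9)} ≤ 1` by `Node00.chiFix29OfRecord_mem_Icc`, `A^η ≥ 0` by
   `Node00.wilsonBGOfRecord_nonneg`); ★★★ `exists_datum_endStatementBPrinted_endpointExistence_of_ae_at_record` — at `datumOfRecord₁₃SepCoPH F 2 θ h`: Theorem 1's clause + (2.50) with
   SOME `em ep` pointwise at level 0 and `dV_k`-a.e. above on the `γ`-windowed runs + `DagBinding.EndpointExistence (datum).C.toB12` ⟹ `∃ D, IsDatumOfRecord₀ F 2 D ∧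
   B16.EndStatementBPrinted D.C ∧ DagBinding.EndpointExistence D.C.toB12 ∧ D.C.toB12 = (datum).C.toB12 ∧ D.βfun = (datum).βfun ∧ D.av = avOfRecord F 2 ∧ (level 0 verbatim) ∧
   (densities =ᵐ above)` — NO sign
   hypothesis (upper exponent enlarged to `max ep (−em)` internally).  These are the first three conjuncts of the rung `BalabanLadder.UV`'s `∃ D` (cell bookkeeping; the rung is
   a Summits statement and is not imported here).

HONEST SCOPE.  (i) Kernel bookkeeping over def-T's ∕ T4DatumAssembly's carriers (a `Set.piecewise` re-choice on null sets; `integral_congr_ae`; `inducedR`); (2.50) is NOT proved in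
any currency; nothing of Bałaban's asserted or refuted.  (ii) NOT transferred: the cell's K3-side `T4ApexHybrid.HybridNE7Under D …`, typed at the record's own `D` with (2.50) pointwise
as HYPOTHESIS (its `D`-dependence is through `D.scheme` ∕ `D.Tuned` ∕ the (B) antecedent — the K3 lanes' ∕ definers' word).  (iii) Level 0 is NOT re-chosen (`rho_zero` is an
equation of functions); there (2.50) is asked pointwise — harmless, `ρ₀ = e^{−E}·exp(−A∕g₀²)` is explicit.  (iv) Count-neutral; N13 NOT discharged; K1⁸ NEITHER proved NOR refuted;
no stub closed; one finite four-torus programme at fixed ε; nothing continuum ∕ ℝ⁴ ∕ OS ∕ mass-gap ∕ Clay.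
-/

noncomputable section

open scoped BigOperators ENNReal NNReal Matrix.Norms.L2Operator

namespace Literature.MathematicalPhysics.QuantumFieldTheory.Balaban1983to89.T4DatumAssembly.TowerReviseAE

open _root_.MeasureTheory
open T4Continuum (T4Family FiniteEpsData)
open Node00

/-! ## §1 WHAT (2.50) AND THEOREM 1's CLAUSE READ OF `M.construction ρ p`; THE UPPER BARRIER -/

section Reads

variable {F : T4Family} {G : Type} [GaugeGroup G] [MeasurableSpace G] [HaarData G] (M : RGMachineCore F G)

/-- **(2.50) at `M.construction ρ p`, level `k`, field `V` READS**: the core's `χ`, `wilsonBG`, the forward flow `genSeq M.βfun p.g0 k`, the site count, and the ONE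
density value `ρ p k V` (`Iff.rfl`). [cite: Balaban1989LargeFieldII, (0.1) pp.355–356; Balaban1988Convergent, Cor. 3 (2.50) p.264 (bookkeeping)] -/
theorem uvIneq_construction_iff (ρ : (p : B12.RunParams) → (k : ℕ) → Density (F.P p.K) k G) (p : B12.RunParams) (k : ℕ)
    (V : GaugeField (F.P p.K) k G) (Em Ep : ℝ) :
    B16.UVIneq (M.construction ρ p) k V Em Ep ↔
      M.χ p k V * Real.exp (-(1 / (FlowStepRuns.genSeq M.βfun p.g0 k) ^ 2 * M.wilsonBG p k V) - Em * (Fintype.card (Site (F.P p.K) k) : ℝ)) ≤ ρ p k V ∧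
        ρ p k V ≤ Real.exp (Ep * (Fintype.card (Site (F.P p.K) k) : ℝ)) :=
  Iff.rfl

/-- **Theorem 1's clause does not read the density tower**: `Thm1Printed (M.construction ρ) ↔ Thm1Printed (M.construction ρ′)` (`Sect2Form` is the core's clause, the
flow is generated forward from `g₀`; `Iff.rfl`). [cite: Balaban1989LargeFieldII, Thm 1 p.355 (bookkeeping)] -/
theorem thm1Printed_construction_iff (ρ ρ' : (p : B12.RunParams) → (k : ℕ) → Density (F.P p.K) k G) :
    B16.Thm1Printed (M.construction ρ) ↔ B16.Thm1Printed (M.construction ρ') :=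
  Iff.rfl

/-- The small-field part does not read the density tower (`T4DatumAssembly.RGMachineCore.construction_toB12`, re-exported). [cite: Balaban1987RG1, Thm 1 p.259 (bookkeeping)] -/
theorem construction_toB12_eq (ρ ρ' : (p : B12.RunParams) → (k : ℕ) → Density (F.P p.K) k G) :
    (M.construction ρ).toB12 = (M.construction ρ').toB12 :=
  rfl

/-- **THE UPPER BARRIER VALUE SATISFIES (2.50)**: if at `V` the printed lower bound does not exceed the printed upper bound, then a density whose value at `V` IS the
upper bound `exp(Ep·|T₁^{(k)}|)` satisfies (2.50) at `V`. [cite: Balaban1989LargeFieldII, (0.1) pp.355–356 (bookkeeping)] -/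
theorem uvIneq_of_eq_upper (ρ : (p : B12.RunParams) → (k : ℕ) → Density (F.P p.K) k G) (p : B12.RunParams) (k : ℕ)
    (V : GaugeField (F.P p.K) k G) (Em Ep : ℝ)
    (hcompat : M.χ p k V * Real.exp (-(1 / (FlowStepRuns.genSeq M.βfun p.g0 k) ^ 2 * M.wilsonBG p k V) - Em * (Fintype.card (Site (F.P p.K) k) : ℝ)) ≤
      Real.exp (Ep * (Fintype.card (Site (F.P p.K) k) : ℝ)))
    (hV : ρ p k V = Real.exp (Ep * (Fintype.card (Site (F.P p.K) k) : ℝ))) :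
    B16.UVIneq (M.construction ρ p) k V Em Ep := by
  rw [uvIneq_construction_iff, hV]
  exact ⟨hcompat, le_rfl⟩

/-- **THE TWO PRINTED BOUNDS ARE COMPATIBLE UNDER THE SIGN CONVENTIONS** `χ ≤ 1`, `0 ≤ A^η`, `0 ≤ Em + Ep`:
`χ·exp(−A∕g² − Em·|T|) ≤ exp(Ep·|T|)`. [cite: Balaban1989LargeFieldII, (0.1) pp.355–356 (bookkeeping)] -/
theorem barrier_le_of_signs {χ A g Em Ep : ℝ} {T : ℕ} (hχ1 : χ ≤ 1) (hA : 0 ≤ A) (hE : 0 ≤ Em + Ep) :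
    χ * Real.exp (-(1 / g ^ 2 * A) - Em * (T : ℝ)) ≤ Real.exp (Ep * (T : ℝ)) := by
  have h1 : Real.exp (-(1 / g ^ 2 * A) - Em * (T : ℝ)) ≤ Real.exp (Ep * (T : ℝ)) := by
    apply Real.exp_le_exp.mpr
    have hT : (0 : ℝ) ≤ T := Nat.cast_nonneg T
    have hgA : 0 ≤ 1 / g ^ 2 * A := mul_nonneg (by positivity) hA
    nlinarith [mul_nonneg hE hT]
  calc χ * Real.exp (-(1 / g ^ 2 * A) - Em * (T : ℝ))
      ≤ 1 * Real.exp (-(1 / g ^ 2 * A) - Em * (T : ℝ)) :=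
        mul_le_mul_of_nonneg_right hχ1 (Real.exp_pos _).le
    _ ≤ Real.exp (Ep * (T : ℝ)) := by rw [one_mul]; exact h1

/-- (2.50) is MONOTONE in the upper exponent: enlarging `Ep` keeps it. [cite: Balaban1989LargeFieldII, (0.1) pp.355–356 (bookkeeping)] -/
theorem uvIneq_mono_upper {D : B16.RunData} {k : ℕ} {V : D.Cfg k} {Em Ep Ep' : ℝ} (h : B16.UVIneq D k V Em Ep) (hle : Ep ≤ Ep') :
    B16.UVIneq D k V Em Ep' := by
  refine ⟨h.1, h.2.trans (Real.exp_le_exp.mpr ?_)⟩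
  exact mul_le_mul_of_nonneg_right hle (Nat.cast_nonneg _)

/-- **WITH THE UPPER EXPONENT `max Ep (−Em)` THE TWO PRINTED BOUNDS ARE ALWAYS COMPATIBLE** under `χ ≤ 1`, `0 ≤ A^η` — no sign hypothesis on `Em, Ep`
(the sibling dag-n13-w2 g4's device `ep ↦ max ep (−em)`): `χ·exp(−A∕g² − Em·|T|) ≤ exp(−Em·|T|) ≤ exp(max Ep (−Em)·|T|)`. [cite: Balaban1989LargeFieldII, (0.1) pp.355–356 (bookkeeping)] -/
theorem barrier_le_max {χ A g Em Ep : ℝ} {T : ℕ} (hχ1 : χ ≤ 1) (hA : 0 ≤ A) :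
    χ * Real.exp (-(1 / g ^ 2 * A) - Em * (T : ℝ)) ≤ Real.exp (max Ep (-Em) * (T : ℝ)) := by
  have hT : (0 : ℝ) ≤ T := Nat.cast_nonneg T
  have hgA : 0 ≤ 1 / g ^ 2 * A := mul_nonneg (by positivity) hA
  have h1 : Real.exp (-(1 / g ^ 2 * A) - Em * (T : ℝ)) ≤ Real.exp (max Ep (-Em) * (T : ℝ)) := by
    apply Real.exp_le_exp.mpr
    have : -Em * (T : ℝ) ≤ max Ep (-Em) * (T : ℝ) := mul_le_mul_of_nonneg_right (le_max_right _ _) hT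
    linarith
  calc χ * Real.exp (-(1 / g ^ 2 * A) - Em * (T : ℝ))
      ≤ 1 * Real.exp (-(1 / g ^ 2 * A) - Em * (T : ℝ)) :=
        mul_le_mul_of_nonneg_right hχ1 (Real.exp_pos _).le
    _ ≤ Real.exp (max Ep (-Em) * (T : ℝ)) := by rw [one_mul]; exact h1

end Reads

/-! ## §2 RE-CHOOSING A TOWER ABOVE LEVEL 0 ON NULL SETS GIVES A TOWER -/

section ReChoose

variable {F : T4Family} {G : Type} [GaugeGroup G] [MeasurableSpace G] [HaarData G] {M : RGMachineCore F G}
  {av : (K j : ℕ) → Averaging (F.P K) j G}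

/-- `IsRT` reads the input density only under `∫ … ∂dU`: a.e.-equal inputs have the same transforms. [cite: Balaban1985Averaging, (10) p.19 (bookkeeping)] -/
theorem isRT_congr_ae_input {P : Params} {j : ℕ} {avg : GaugeField P j G → GaugeField P (j + 1) G} {ρ₁ ρ₂ : Density P j G}
    {ρ' : Density P (j + 1) G} (h : IsRT avg ρ₁ ρ') (h12 : ρ₁ =ᵐ[fieldMeasure P j G] ρ₂) : IsRT avg ρ₂ ρ' := by
  intro f hf hbd
  rw [h f hf hbd]
  refine integral_congr_ae ?_
  filter_upwards [h12] with U hU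
  rw [hU]

open Classical in
/-- **★ RE-CHOOSING A TOWER ABOVE LEVEL 0 ON NULL SETS GIVES A TOWER** with the same `Tρ_k` and the same level 0: given guards `B p (k+1)` that are `dV_{k+1}`-null (every
`p`, `k`) and replacement values `σ p k`, the densities `ρ′ p 0 := ρ p 0`, `ρ′ p (k+1) := σ p (k+1)` ON `B p (k+1)` and `ρ p (k+1)` OFF it carry the three tower
obligations (`rho_zero` verbatim; `isRT_Trho`, `integral_succ` by a.e.-congruence). [cite: Balaban1988Convergent, (0.2) p.244; Balaban1989LargeFieldI, (0.4) p.176 (bookkeeping over def-T's tower obligations)] -/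
theorem exists_tower_reChosen_above_zero (τ : M.Tower av)
    (B : (p : B12.RunParams) → (k : ℕ) → Set (GaugeField (F.P p.K) k G))
    (σ : (p : B12.RunParams) → (k : ℕ) → Density (F.P p.K) k G)
    (hB : ∀ (p : B12.RunParams) (k : ℕ), fieldMeasure (F.P p.K) (k + 1) G (B p (k + 1)) = 0) :
    ∃ τ' : M.Tower av,
      (∀ p, τ'.ρ p 0 = τ.ρ p 0) ∧
      (∀ (p : B12.RunParams) (k : ℕ) (V : GaugeField (F.P p.K) (k + 1) G), V ∈ B p (k + 1) → τ'.ρ p (k + 1) V = σ p (k + 1) V) ∧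
      (∀ (p : B12.RunParams) (k : ℕ) (V : GaugeField (F.P p.K) (k + 1) G), V ∉ B p (k + 1) → τ'.ρ p (k + 1) V = τ.ρ p (k + 1) V) ∧
      (∀ (p : B12.RunParams) (k : ℕ), τ'.ρ p (k + 1) =ᵐ[fieldMeasure (F.P p.K) (k + 1) G] τ.ρ p (k + 1)) ∧
      (∀ p k, τ'.Trho p k = τ.Trho p k) := by
  let ρ' : (p : B12.RunParams) → (k : ℕ) → Density (F.P p.K) k G := fun p k =>
    match k with
    | 0 => τ.ρ p 0
    | k + 1 => (B p (k + 1)).piecewise (σ p (k + 1)) (τ.ρ p (k + 1))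
  have hρ'0 : ∀ p, ρ' p 0 = τ.ρ p 0 := fun p => rfl
  have hin : ∀ (p : B12.RunParams) (k : ℕ) (V : GaugeField (F.P p.K) (k + 1) G), V ∈ B p (k + 1) → ρ' p (k + 1) V = σ p (k + 1) V :=
    fun p k V hV => Set.piecewise_eq_of_mem _ _ _ hV
  have hout : ∀ (p : B12.RunParams) (k : ℕ) (V : GaugeField (F.P p.K) (k + 1) G), V ∉ B p (k + 1) → ρ' p (k + 1) V = τ.ρ p (k + 1) V :=
    fun p k V hV => Set.piecewise_eq_of_notMem _ _ _ hV
  have hae : ∀ (p : B12.RunParams) (k : ℕ), ρ' p (k + 1) =ᵐ[fieldMeasure (F.P p.K) (k + 1) G] τ.ρ p (k + 1) := by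
    intro p k
    filter_upwards [measure_eq_zero_iff_ae_notMem.1 (hB p k)] with V hV
    exact hout p k V hV
  have hae' : ∀ (p : B12.RunParams) (k : ℕ), ρ' p k =ᵐ[fieldMeasure (F.P p.K) k G] τ.ρ p k := by
    intro p k
    cases k with
    | zero => exact Filter.EventuallyEq.rfl
    | succ k => exact hae p k
  refine ⟨{ ρ := ρ'
            Trho := τ.Trho
            rho_zero := fun p => by rw [hρ'0]; exact τ.rho_zero p
            isRT_Trho := fun p k hk => isRT_congr_ae_input (τ.isRT_Trho p k hk) (hae' p k).symm
            integral_succ := fun p k hk => by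
              rw [← τ.integral_succ p k hk]
              exact integral_congr_ae (hae p k) }, hρ'0, hin, hout, hae, fun p k => rfl⟩

end ReChoose

/-! ## §3 FROM (2.50) POINTWISE AT LEVEL 0 AND A.E. ABOVE: A RE-CHOSEN TOWER WITH `EndStatementBPrinted` AS TYPED; ITS DATUM -/

section AE

variable {F : T4Family} {G : Type} [GaugeGroup G] [MeasurableSpace G] [HaarData G] (M : RGMachineCore F G)
  {av : (K j : ℕ) → Averaging (F.P K) j G}

open Classical in
/-- **★★ A TOWER SATISFYING (2.50) POINTWISE AT LEVEL 0 AND `dV_k`-A.E. AT LEVELS `k ≥ 1` (γ-windowed runs) RE-CHOOSES TO A TOWER WITH [B16]'s END STATEMENT AS TYPED.**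
Hypotheses: Theorem 1's clause for `M.construction τ.ρ` (it does not read `ρ`); for every `γ`-windowed run `p`: (2.50) with `em ep` at `k = 0` for EVERY field, and for
`dV_{k+1}`-almost every field at `k + 1 ≤ K`; at every field of every level `k + 1 ≤ K` of a windowed run the two printed bounds are compatible (e.g. `barrier_le_of_signs`).
Conclusion: a tower `τ′` with the same level 0, the same `Tρ_k`, `τ′.ρ p (k+1) =ᵐ τ.ρ p (k+1)`, and `B16.EndStatementBPrinted (M.construction τ′.ρ)`.
PROOF: §2 with guard `B p (k+1) := {V | windowed ∧ k+1 ≤ K ∧ ¬(2.50) at V}` (null by hypothesis) and replacement the upper barrier; §1.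
[cite: Balaban1989LargeFieldII, Thm 1 p.355, (0.1) pp.355–356; Balaban1988Convergent, Cor. 3 (2.50) p.264, (0.2) p.244 (bookkeeping)] -/
theorem exists_tower_endStatementBPrinted_of_ae (τ : M.Tower av) {γ : ℝ} (hγ : 0 < γ) (em ep : ℝ → ℝ)
    (h1 : B16.Thm1Printed (M.construction τ.ρ))
    (h0 : ∀ p : B12.RunParams, (M.construction τ.ρ p).flow.InInterval γ p.K →
      ∀ V : GaugeField (F.P p.K) 0 G, B16.UVIneq (M.construction τ.ρ p) 0 V (em ((M.construction τ.ρ p).flow.g 0)) (ep ((M.construction τ.ρ p).flow.g 0)))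
    (hae : ∀ p : B12.RunParams, (M.construction τ.ρ p).flow.InInterval γ p.K → ∀ k : ℕ, k + 1 ≤ p.K →
      ∀ᵐ V ∂fieldMeasure (F.P p.K) (k + 1) G,
        B16.UVIneq (M.construction τ.ρ p) (k + 1) V (em ((M.construction τ.ρ p).flow.g (k + 1))) (ep ((M.construction τ.ρ p).flow.g (k + 1))))
    (hcompat : ∀ p : B12.RunParams, (M.construction τ.ρ p).flow.InInterval γ p.K → ∀ k : ℕ, k + 1 ≤ p.K → ∀ V : GaugeField (F.P p.K) (k + 1) G,
      M.χ p (k + 1) V * Real.exp (-(1 / (FlowStepRuns.genSeq M.βfun p.g0 (k + 1)) ^ 2 * M.wilsonBG p (k + 1) V)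
          - em (FlowStepRuns.genSeq M.βfun p.g0 (k + 1)) * (Fintype.card (Site (F.P p.K) (k + 1)) : ℝ)) ≤
        Real.exp (ep (FlowStepRuns.genSeq M.βfun p.g0 (k + 1)) * (Fintype.card (Site (F.P p.K) (k + 1)) : ℝ))) :
    ∃ τ' : M.Tower av,
      (∀ p, τ'.ρ p 0 = τ.ρ p 0) ∧
      (∀ (p : B12.RunParams) (k : ℕ), τ'.ρ p (k + 1) =ᵐ[fieldMeasure (F.P p.K) (k + 1) G] τ.ρ p (k + 1)) ∧
      (∀ p k, τ'.Trho p k = τ.Trho p k) ∧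
      B16.EndStatementBPrinted (M.construction τ'.ρ) := by
  -- guard: windowed ∧ in range ∧ (2.50) fails at V; replacement: the upper barrier
  let B : (p : B12.RunParams) → (k : ℕ) → Set (GaugeField (F.P p.K) k G) := fun p k =>
    {V | (M.construction τ.ρ p).flow.InInterval γ p.K ∧ k ≤ p.K ∧
      ¬ B16.UVIneq (M.construction τ.ρ p) k V (em ((M.construction τ.ρ p).flow.g k)) (ep ((M.construction τ.ρ p).flow.g k))}
  let σ : (p : B12.RunParams) → (k : ℕ) → Density (F.P p.K) k G := fun p k _ =>
    Real.exp (ep (FlowStepRuns.genSeq M.βfun p.g0 k) * (Fintype.card (Site (F.P p.K) k) : ℝ))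
  have hBnull : ∀ (p : B12.RunParams) (k : ℕ), fieldMeasure (F.P p.K) (k + 1) G (B p (k + 1)) = 0 := by
    intro p k
    by_cases hw : (M.construction τ.ρ p).flow.InInterval γ p.K ∧ k + 1 ≤ p.K
    · have h := hae p hw.1 k hw.2
      rw [Filter.Eventually, mem_ae_iff] at h
      refine measure_mono_null (fun V hV => ?_) h
      exact hV.2.2
    · have hempty : B p (k + 1) = ∅ := Set.eq_empty_of_forall_notMem fun V hV => hw ⟨hV.1, hV.2.1⟩
      rw [hempty, measure_empty]
  obtain ⟨τ', hρ0, hin, hout, hρae, hT⟩ := exists_tower_reChosen_above_zero τ B σ hBnull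
  refine ⟨τ', hρ0, hρae, hT, ?_, ?_⟩
  · exact (thm1Printed_construction_iff M τ'.ρ τ.ρ).mpr h1
  · refine ⟨γ, hγ, em, ep, fun p hp k hk V => ?_⟩
    -- the flow of `M.construction τ'.ρ p` is that of `M.construction τ.ρ p` (`rfl`)
    change (M.construction τ.ρ p).flow.InInterval γ p.K at hp
    cases k with
    | zero =>
        have h := h0 p hp V
        rw [uvIneq_construction_iff] at h ⊢
        rw [hρ0]
        exact h
    | succ k =>
        by_cases hgood : B16.UVIneq (M.construction τ.ρ p) (k + 1) V
            (em ((M.construction τ.ρ p).flow.g (k + 1))) (ep ((M.construction τ.ρ p).flow.g (k + 1)))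
        · have hnot : V ∉ B p (k + 1) := fun hV => hV.2.2 hgood
          have hval : τ'.ρ p (k + 1) V = τ.ρ p (k + 1) V := hout p k V hnot
          rw [uvIneq_construction_iff] at hgood ⊢
          rw [hval]
          exact hgood
        · have hmem : V ∈ B p (k + 1) := ⟨hp, hk, hgood⟩
          have hval : τ'.ρ p (k + 1) V = Real.exp (ep (FlowStepRuns.genSeq M.βfun p.g0 (k + 1)) * (Fintype.card (Site (F.P p.K) (k + 1)) : ℝ)) :=
            hin p k V hmem
          exact uvIneq_of_eq_upper M τ'.ρ p (k + 1) V _ _ (hcompat p hp k hk V) hval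

end AE

/-! ## §3b THE DATUM OF THE RE-CHOSEN TOWER AT `SU(N)` AND NODE 00's AVERAGING -/

section Datum

variable (F : T4Family) (N : ℕ) [NeZero N] (M : RGMachineCore F (SU N))

open Classical in
/-- **★★ THE DATUM OF THE RE-CHOSEN TOWER**: under the hypotheses of `exists_tower_endStatementBPrinted_of_ae` at `G = SU(N)`, `av = Node00.avOfRecord F N`, there is a finite-`ε`
datum `D′ = datumOfTower F N M τ′` with `IsDatumOfRecord₀ F N D′`, the SAME small-field part `D′.C.toB12 = (datumOfTower F N M τ).C.toB12` (hence the same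
`DagBinding.EndpointExistence`), the SAME β-functions, the SAME level-0 densities, densities `=ᵐ` the given tower's at every level `k+1 ≤ K`, and `B16.EndStatementBPrinted D′.C`
AS TYPED. [cite: Balaban1989LargeFieldII, Thm 1 + (0.1) pp.355–356; Balaban1988Convergent, (0.2) p.244, Cor. 3 (2.50) p.264 (bookkeeping over T4DatumAssembly's `datumOfTower`)] -/
theorem exists_datum_endStatementBPrinted_of_ae (τ : M.Tower (avOfRecord F N)) {γ : ℝ} (hγ : 0 < γ) (em ep : ℝ → ℝ)
    (h1 : B16.Thm1Printed (datumOfTower F N M τ).C)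
    (h0 : ∀ p : B12.RunParams, ((datumOfTower F N M τ).C p).flow.InInterval γ p.K →
      ∀ V : GaugeField (F.P p.K) 0 (SU N),
        B16.UVIneq ((datumOfTower F N M τ).C p) 0 V (em (((datumOfTower F N M τ).C p).flow.g 0)) (ep (((datumOfTower F N M τ).C p).flow.g 0)))
    (hae : ∀ p : B12.RunParams, ((datumOfTower F N M τ).C p).flow.InInterval γ p.K → ∀ k : ℕ, k + 1 ≤ p.K →
      ∀ᵐ V ∂fieldMeasure (F.P p.K) (k + 1) (SU N),
        B16.UVIneq ((datumOfTower F N M τ).C p) (k + 1) V (em (((datumOfTower F N M τ).C p).flow.g (k + 1)))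
          (ep (((datumOfTower F N M τ).C p).flow.g (k + 1))))
    (hcompat : ∀ p : B12.RunParams, ((datumOfTower F N M τ).C p).flow.InInterval γ p.K → ∀ k : ℕ, k + 1 ≤ p.K →
      ∀ V : GaugeField (F.P p.K) (k + 1) (SU N),
        M.χ p (k + 1) V * Real.exp (-(1 / (FlowStepRuns.genSeq M.βfun p.g0 (k + 1)) ^ 2 * M.wilsonBG p (k + 1) V)
            - em (FlowStepRuns.genSeq M.βfun p.g0 (k + 1)) * (Fintype.card (Site (F.P p.K) (k + 1)) : ℝ)) ≤
          Real.exp (ep (FlowStepRuns.genSeq M.βfun p.g0 (k + 1)) * (Fintype.card (Site (F.P p.K) (k + 1)) : ℝ))) :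
    ∃ D : FiniteEpsData F (SU N),
      IsDatumOfRecord₀ F N D ∧ D.C.toB12 = (datumOfTower F N M τ).C.toB12 ∧ D.βfun = (datumOfTower F N M τ).βfun ∧ D.av = avOfRecord F N ∧
        (∀ K g₀, D.dens K g₀ 0 = (datumOfTower F N M τ).dens K g₀ 0) ∧
        (∀ (K : ℕ) (g₀ : ℝ) (k : ℕ), D.dens K g₀ (k + 1) =ᵐ[fieldMeasure (F.P K) (k + 1) (SU N)] (datumOfTower F N M τ).dens K g₀ (k + 1)) ∧
        B16.EndStatementBPrinted D.C := by
  obtain ⟨τ', hρ0, hρs, _hT, hB⟩ := exists_tower_endStatementBPrinted_of_ae M τ hγ em ep h1 h0 hae hcompat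
  refine ⟨datumOfTower F N M τ', isDatumOfRecord₀_datumOfTower F N M τ', rfl, rfl, rfl, fun K g₀ => ?_, fun K g₀ k => ?_, hB⟩
  · rw [dens_datumOfTower, dens_datumOfTower]
    exact hρ0 ⟨K, F.m, g₀⟩
  · rw [dens_datumOfTower, dens_datumOfTower]
    exact hρs ⟨K, F.m, g₀⟩ k

end Datum

/-! ## §4 [record, `N = 2`] THE RUNG's `∃ D` FIRST THREE CONJUNCTS FROM AN A.E. EDITION OF (B) AT NODE 00's STAGE-13 RECORD -/

section Record

variable {F : T4Family}

/-- The Stage-13 datum of record IS a tower datum (`rfl`; def-T's `datumOfRecord₁₃SepCoPH := datumOfTower F N (coreOfRecord₁₃CoPH θ) (towerOfRecord₁₃SepCoPH θ h)`).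
[cite: Balaban1989LargeFieldII, Thm 1 + (0.1) pp.355–356 (bookkeeping)] -/
theorem datumOfRecord₁₃SepCoPH_eq_datumOfTower (θ : Stage13HParams F 2) (h : θ.Provisos₁₃SepCoPH F 2) :
    datumOfRecord₁₃SepCoPH F 2 θ h = datumOfTower F 2 (coreOfRecord₁₃CoPH F 2 θ) (towerOfRecord₁₃SepCoPH F 2 θ h) :=
  rfl

/-- **At the record the printed bounds with upper exponent `max ep (−em)` are compatible at every field — NO sign hypothesis**: the β-slot cut-off of record is
`χ^{(2.9)} ∈ {0, 1}` (K0e's `chiFix29OfRecord_mem_Icc`) and `A^η(U_k(V)) ≥ 0` (def-B's `wilsonBGOfRecord_nonneg`); §1's `barrier_le_max`.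
[cite: Balaban1987RG1, (2.9) p.266, (0.2) p.252; Balaban1989LargeFieldII, (0.1) pp.355–356 (bookkeeping)] -/
theorem compat_at_record_max (θ : Stage13HParams F 2) (em ep : ℝ → ℝ) (p : B12.RunParams) (k : ℕ) (V : GaugeField (F.P p.K) (k + 1) (SU 2)) :
    (coreOfRecord₁₃CoPH F 2 θ).χ p (k + 1) V *
        Real.exp (-(1 / (FlowStepRuns.genSeq (coreOfRecord₁₃CoPH F 2 θ).βfun p.g0 (k + 1)) ^ 2 * (coreOfRecord₁₃CoPH F 2 θ).wilsonBG p (k + 1) V)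
          - em (FlowStepRuns.genSeq (coreOfRecord₁₃CoPH F 2 θ).βfun p.g0 (k + 1)) * (Fintype.card (Site (F.P p.K) (k + 1)) : ℝ)) ≤
      Real.exp ((fun g => max (ep g) (-em g)) (FlowStepRuns.genSeq (coreOfRecord₁₃CoPH F 2 θ).βfun p.g0 (k + 1)) *
        (Fintype.card (Site (F.P p.K) (k + 1)) : ℝ)) := by
  have hχ : (coreOfRecord₁₃CoPH F 2 θ).χ p (k + 1) V ≤ 1 := by
    show chiFix29OfRecord F 2 θ.ν θ.ε₂₉ p.K (k + 1) V ≤ 1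
    exact (chiFix29OfRecord_mem_Icc θ.ν θ.ε₂₉ p.K (k + 1) V).2
  have hA : 0 ≤ (coreOfRecord₁₃CoPH F 2 θ).wilsonBG p (k + 1) V := wilsonBGOfRecord_nonneg F 2 θ.εbg p (k + 1) V
  exact barrier_le_max hχ hA

open Classical in
/-- **★★★ THE RUNG's `∃ D` — FIRST THREE CONJUNCTS — FROM AN A.E. EDITION OF (B) AT THE RECORD, NO SIGN HYPOTHESIS.**  At `datumOfRecord₁₃SepCoPH F 2 θ h`: Theorem 1's clause;
(2.50) with SOME `em ep` on the `γ`-windowed runs POINTWISE at level 0 and `dV_k`-A.E. at levels `1 ≤ k ≤ K`; and K2⁸'s output `DagBinding.EndpointExistence (datum).C.toB12`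
⟹ a datum `D` with `IsDatumOfRecord₀ F 2 D ∧ B16.EndStatementBPrinted D.C ∧ DagBinding.EndpointExistence D.C.toB12`, the record's β-functions and averaging, the record's
level-0 densities and densities `=ᵐ` the record's above.  (Internally the upper exponent is enlarged to `max ep (−em)`, `compat_at_record_max`; K3⁷'s `HybridNE7Under D …` is NOT
transferred here.) [cite: Balaban1989LargeFieldII, Thm 1 + (0.1) pp.355–356; Balaban1988Convergent, Cor. 3 (2.50) p.264, (0.2) p.244; Balaban1987RG1, Thm 2 p.259 (bookkeeping)] -/
theorem exists_datum_endStatementBPrinted_endpointExistence_of_ae_at_record (θ : Stage13HParams F 2) (h : θ.Provisos₁₃SepCoPH F 2)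
    {γ : ℝ} (hγ : 0 < γ) (em ep : ℝ → ℝ)
    (h1 : B16.Thm1Printed (datumOfRecord₁₃SepCoPH F 2 θ h).C)
    (h0 : ∀ p : B12.RunParams, ((datumOfRecord₁₃SepCoPH F 2 θ h).C p).flow.InInterval γ p.K →
      ∀ V : GaugeField (F.P p.K) 0 (SU 2),
        B16.UVIneq ((datumOfRecord₁₃SepCoPH F 2 θ h).C p) 0 V (em (((datumOfRecord₁₃SepCoPH F 2 θ h).C p).flow.g 0))
          (ep (((datumOfRecord₁₃SepCoPH F 2 θ h).C p).flow.g 0)))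
    (hae : ∀ p : B12.RunParams, ((datumOfRecord₁₃SepCoPH F 2 θ h).C p).flow.InInterval γ p.K → ∀ k : ℕ, k + 1 ≤ p.K →
      ∀ᵐ V ∂fieldMeasure (F.P p.K) (k + 1) (SU 2),
        B16.UVIneq ((datumOfRecord₁₃SepCoPH F 2 θ h).C p) (k + 1) V (em (((datumOfRecord₁₃SepCoPH F 2 θ h).C p).flow.g (k + 1)))
          (ep (((datumOfRecord₁₃SepCoPH F 2 θ h).C p).flow.g (k + 1))))
    (hend : DagBinding.EndpointExistence (datumOfRecord₁₃SepCoPH F 2 θ h).C.toB12) :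
    ∃ D : FiniteEpsData F (SU 2),
      IsDatumOfRecord₀ F 2 D ∧ B16.EndStatementBPrinted D.C ∧ DagBinding.EndpointExistence D.C.toB12 ∧
        D.C.toB12 = (datumOfRecord₁₃SepCoPH F 2 θ h).C.toB12 ∧ D.βfun = (datumOfRecord₁₃SepCoPH F 2 θ h).βfun ∧ D.av = avOfRecord F 2 ∧
        (∀ K g₀, D.dens K g₀ 0 = (datumOfRecord₁₃SepCoPH F 2 θ h).dens K g₀ 0) ∧
        (∀ (K : ℕ) (g₀ : ℝ) (k : ℕ),
          D.dens K g₀ (k + 1) =ᵐ[fieldMeasure (F.P K) (k + 1) (SU 2)] (datumOfRecord₁₃SepCoPH F 2 θ h).dens K g₀ (k + 1)) := by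
  -- enlarge the upper exponent to `max ep (−em)`: the hypotheses persist, compatibility becomes free
  have hle : ∀ g, ep g ≤ (fun g => max (ep g) (-em g)) g := fun g => le_max_left _ _
  obtain ⟨D, hD0, hB12, hβ, hav, hd0, hds, hB⟩ :=
    exists_datum_endStatementBPrinted_of_ae F 2 (coreOfRecord₁₃CoPH F 2 θ) (towerOfRecord₁₃SepCoPH F 2 θ h) hγ em (fun g => max (ep g) (-em g)) h1
      (fun p hp V => uvIneq_mono_upper (h0 p hp V) (hle _))
      (fun p hp k hk => by
        filter_upwards [hae p hp k hk] with V hV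
        exact uvIneq_mono_upper hV (hle _))
      (fun p _ k _ V => compat_at_record_max θ em ep p k V)
  refine ⟨D, hD0, hB, ?_, hB12, hβ, hav, hd0, hds⟩
  rw [hB12]
  exact hend

end Record

end Literature.MathematicalPhysics.QuantumFieldTheory.Balaban1983to89.T4DatumAssembly.TowerReviseAE

end
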